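import Literature.AnabelianGeometry.SemiGraphs.TemperedDecompositionCuspOmission
import Literature.AnabelianGeometry.SemiGraphs.SpecialFibreConjugationDecompTransport
import HarnessLib

/-!
# The `hHstab` of [IUTchI] Cor. 2.3 (i) DERIVED in the currency `decompSubgroups S.chart ℍ` of the special fibre
# WITH cusps; hypothesis-free for node-full `ℍ` (proof-only)

Mochizuki, *Inter-universal Teichmüller theory I*, §2 p. 44 l. 39–44 (decomposition groups `Π^tp_ℍ ⊆ Π^tp_𝔾`
"well-defined up to conjugation", read after "omitting cuspidal edges"), p. 47 l. 22–24 ("`ℍ ⊆ 𝔾` is stabilized by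
the natural action of `G_k` on `𝔾`"), Cor. 2.3 (i) p. 47 ("the natural outer actions of `G_k` on `Δ^tp_X` …
determine natural outer actions of `G_k` on `Δ^tp_{X,ℍ}`") [cite: Mochizuki2012, IUTchI Cor 2.3(i) p.47]
[claim: Mochizuki2012, status: disputed] (nothing of the IUT series is asserted here); Mochizuki, *Semi-graphs of
anabelioids*, Publ. RIMS **42** (2006), Ex. 3.10 p. 44, Cor. 3.9 pp. 42–43 [cite: MochizukiSemiAnbd2006, Cor 3.9 pp.42-43].

abc-iut cell, layer L3, seat abc-iut-L3-d1 gen 12, row «AUTOFCONJ-INDUCES-UPTOTWIST + HHSTAB-DERIVED@FINITE-SPECIAL-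
FIBRE», STAGE 2 (L3-lead δ1 (4)): the JUNCTION of stage 1 (`SpecialFibreConjugationDecompTransport.lean`:
decomposition subgroups of `ℍ₀ = ℍ ∩ 𝒢` in the cusp-omitted fibre, transported chart) with abc-iut-L5's currency
`S.chart.decompSubgroups ℍ` (`ℍ ⊆ 𝔾^c` WITH cusps), via the cusp-omission invariance of decomposition subgroups
(`TemperedDecompositionCuspOmission.lean`).  PROOF-ONLY (no definition, no instance, no notation, no `Prop` fact).

WHAT IS PROVED.
* §3 at special-fibre data `S`: `SpecialFibreData.decompSubgroups_eq_graphOf(_of_isConnected)` —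
  `decompSubgroups S.chart ℍ = decompSubgroups cS (ℍ ∩ 𝒢)`; ★ `exists_conj_map_autOfConj_of_mem_decompSubgroups_Gc`
  — stage 1's derived `hHstab` for `D ∈ S.chart.decompSubgroups ℍ`, `ℍ ⊆ 𝔾^c` connected with a vertex.
* §4 at the origin record `P : SpecialFibreTower.PiData` (finite base fibre; `ℍ := P.H` is connected with a vertex):
  ★★ `PiData.hHstab_of_mem_decompSubgroups_of_edgeStable` — for EVERY `Π^tp_ℍ := TpH ∈ S.chart.decompSubgroups P.H`
  and every `g ∈ Π^tp_X`, `∃ t, TpH.map (autOfConj g) = MulAut.conj t • TpH` — VERBATIM the conclusion of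
  abc-iut-L5's `hHstab_of_mem_decompSubgroups_of_graphic` (`TemperedCoveringsCor23OfSpecialFibreDecompGraphic.lean`)
  with its hypothesis `hgr = P.ActGraphInduces` (the origin datum p484597) REPLACED by the stability of the NODES of
  `ℍ` under the base of the (unique, Cor. 3.9 (b)) isomorphisms `𝒢 ⥲ 𝒢` compatible with `autOfConj g`
  (vertex-stability is automatic: `H_stable` + derived vertex map = `actGraph₀ g`); `hHstab_at_of_graphCompatible`.
* §5 ★★★ `PiData.hHstab_of_mem_decompSubgroups_of_full` — for NODE-FULL `ℍ` (a node of `𝔾^c` lies in `ℍ` iff both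
  its end-vertices do — a condition on the record's `ℍ` alone) `hHstab` holds for every decomposition group and every
  `g`, HYPOTHESIS-FREE beyond node-fullness: no origin datum, no cusp matching, no edge binder
  (`SemiGraph.Subgraph.mem_edges_iff_edgeMap_mem_of_full`: an automorphism of a semi-graph stabilising the vertices
  of a full sub-semi-graph stabilises its edges).

HONEST RESIDUAL.  For a NON-full `ℍ` (parallel nodes only some of which lie in `ℍ` — abc-iut-L3-lead γ32 (2) witness)
the stability of the edges of `ℍ` under the DERIVED isomorphisms stays displayed (`hHE`): the record's `actGraph₀ g` on
edges carries no law, so `P.H_stable` does not discharge it.  Nothing here is a claim about print beyond OUR finite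
carriers; no side is taken on [IUTchIII] Cor. 3.12; nothing here asserts that abc is proved or refuted; typed ≠ proved.
-/

noncomputable section

namespace Literature.AnabelianGeometry.SemiGraphs

open CategoryTheory ProfiniteSemiGraph
open scoped Pointwise

universe u

/-! ### §3. At special-fibre data: `decompSubgroups S.chart ℍ = decompSubgroups cS (ℍ ∩ 𝒢)`; `hHstab` WITH cusps -/

namespace SpecialFibreData

variable {K : Type u} [Field K] {D : TemperedArithmeticGroup K} (S : SpecialFibreData D)

/-- **The decomposition subgroups `Π^tp_ℍ ⊆ π₁^temp(𝒢^c)` of `ℍ ⊆ 𝔾^c` are those of `ℍ ∩ 𝒢 ⊆ 𝒢`** (cusps of `ℍ`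
omitted) for the transported chart of the cusp-omitted fibre `𝒢` — whenever every cusp of `𝔾^c` lying in `ℍ` abuts
inside `ℍ`. [cite: Mochizuki2012, IUTchI §2 p.44] -/
theorem decompSubgroups_eq_graphOf (H : S.Gc.graph.Subgraph)
    (hcusp : ∀ (b : S.Gc.graph.Branch) (w : S.Gc.graph.Vertex), S.Gc.graph.edgeOf b ∈ H.edges →
      S.Gc.graph.edgeOf b ∉ S.Gc.graph.maximalSubgraph.edges → S.Gc.graph.abuts b = some w → w ∈ H.verts) :
    S.chart.decompSubgroups H =
      (S.chart.transport (haveI := S.isEquivalence_btempRestrict_graphOf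
        (S.Gc.btempRestrict S.Gc.graph.maximalSubgraph).asEquivalence.symm)).decompSubgroups
        (H.restrictTo S.Gc.graph.maximalSubgraph) :=
  S.chart.decompSubgroups_eq_transport_restrictTo S.maximalSubgraph_isCuspOmission
    (SemiGraph.Subgraph.isCuspOmission_restrictTo_of_abuts_mem S.maximalSubgraph_isCuspOmission H hcusp)

/-- The same for CONNECTED `ℍ` with a vertex (no cusp hypothesis). [cite: Mochizuki2012, IUTchI §2 p.44] -/
theorem decompSubgroups_eq_graphOf_of_isConnected (H : S.Gc.graph.Subgraph) (hH : H.toSemiGraph.IsConnected)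
    (hHv : H.verts.Nonempty) :
    S.chart.decompSubgroups H =
      (S.chart.transport (haveI := S.isEquivalence_btempRestrict_graphOf
        (S.Gc.btempRestrict S.Gc.graph.maximalSubgraph).asEquivalence.symm)).decompSubgroups
        (H.restrictTo S.Gc.graph.maximalSubgraph) :=
  S.chart.decompSubgroups_eq_transport_restrictTo S.maximalSubgraph_isCuspOmission
    (SemiGraph.Subgraph.isCuspOmission_restrictTo_of_isConnected S.maximalSubgraph_isCuspOmission H hH hHv)

/-- ★ **`hHstab` of [IUTchI] Cor. 2.3 (i) DERIVED from Cor. 3.9 at finite special fibres, in the currency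
`S.chart.decompSubgroups ℍ` (`ℍ ⊆ 𝔾^c` WITH cusps, connected with a vertex)**: for every `g ∈ Π`, if the VERTICES of
`ℍ` are stable under the derived vertex action `actVertex g` and the NODES of `ℍ` are stable under the base of the
(every) isomorphism `𝒢 ⥲ 𝒢` compatible with `autOfConj g`, then every decomposition subgroup `D ∈ decompSubgroups
S.chart ℍ` satisfies `D.map (autOfConj g) = MulAut.conj t • D` for some `t ∈ π₁^temp(𝒢^c)`.
[cite: Mochizuki2012, IUTchI Cor 2.3(i) p.47] -/
theorem exists_conj_map_autOfConj_of_mem_decompSubgroups_Gc [Finite S.Gc.graph.Vertex]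
    [Finite S.Gc.graph.Edge] (hK0 : (S.admissible.toMonoidHom.ker.map D.delta.subtype).Normal) (g : D.Pi)
    {H : S.Gc.graph.Subgraph} (hH : H.toSemiGraph.IsConnected) (hHv : H.verts.Nonempty)
    (hHV : ∀ v : S.Gc.graph.Vertex, v ∈ H.verts ↔
      S.actVertex hK0 maximalCompactIffVerticialAt_of_finiteGraph g v ∈ H.verts)
    (hHE : ∀ F₀ : Hom S.graph S.graph, F₀.IsIso → S.GraphCompatible S (S.autOfConj hK0 g) F₀ →
      ∀ e : S.graph.graph.Edge, e.1 ∈ H.edges ↔ (F₀.base.edgeMap e).1 ∈ H.edges)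
    {Dg : Subgroup S.chart.G} (hD : Dg ∈ S.chart.decompSubgroups H) :
    ∃ t : S.chart.G, Dg.map (S.autOfConj hK0 g).toMulEquiv.toMonoidHom = MulAut.conj t • Dg := by
  rw [S.decompSubgroups_eq_graphOf_of_isConnected H hH hHv] at hD
  exact S.exists_conj_map_autOfConj_of_mem_decompSubgroups hK0 g (H₀ := H.restrictTo S.Gc.graph.maximalSubgraph)
    (fun v => hHV v.1) (fun F₀ hF₀ hc e => hHE F₀ hF₀ hc e) hD

end SpecialFibreData

/-! ### §4. At the origin record `PiData`: L5's `hHstab` WITHOUT the datum `ActGraphInduces` -/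

namespace SpecialFibreTower

namespace PiData

open SpecialFibreData

variable {p : ℕ} [Fact p.Prime] {X : TemperedCurve p} {d : X.GroupLevelData}
  {S : SpecialFibreData (X.toTemperedArithmeticGroup d)} {T : SpecialFibreTower X.DeltaTemp}

/-- The record's `ℍ` has a vertex (`baseVertex`). [cite: Mochizuki2012, Cor 2.3 p.45] -/
theorem H_verts_nonempty (P : PiData X d S T) : P.H.verts.Nonempty := ⟨P.baseVertex, P.baseVertex_mem⟩

/-- At the origin record, **the decomposition subgroups of the record's `ℍ ⊆ 𝔾^c` are those of `ℍ ∩ 𝒢`** in the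
cusp-omitted base fibre (transported chart): `ℍ` is connected with a vertex, so no cusp hypothesis is needed.
[cite: Mochizuki2012, IUTchI §2 p.44] -/
theorem decompSubgroups_H_eq_graphOf (P : PiData X d S T) :
    S.chart.decompSubgroups P.H =
      (S.chart.transport (haveI := S.isEquivalence_btempRestrict_graphOf
        (S.Gc.btempRestrict S.Gc.graph.maximalSubgraph).asEquivalence.symm)).decompSubgroups
        (P.H.restrictTo S.Gc.graph.maximalSubgraph) :=
  S.decompSubgroups_eq_graphOf_of_isConnected P.H P.H_connected P.H_verts_nonempty

/-- ★★ **`hHstab` at the origin record, DERIVED — abc-iut-L5's `hHstab_of_mem_decompSubgroups_of_graphic` WITHOUT its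
hypothesis `hgr = P.ActGraphInduces`**: for `P : PiData` (finite base fibre), every decomposition group
`Π^tp_ℍ := TpH ∈ decompSubgroups S.chart P.H` of the record's `ℍ` and every `g ∈ Π^tp_X`, PROVIDED the NODES of `ℍ`
are stable under the base of the (every) isomorphism `𝒢 ⥲ 𝒢` compatible with `autOfConj g` (Cor. 3.9 (b): that base is
unique; the record's own `actGraph₀ g` agrees with it on vertices but carries no law on edges):
`∃ t, TpH.map (autOfConj g) = MulAut.conj t • TpH` ([IUTchI] Cor. 2.3 (i): "the natural outer actions of `G_k` on
`Δ^tp_X` … determine natural outer actions of `G_k` on `Δ^tp_{X,ℍ}`", group form).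
[cite: Mochizuki2012, IUTchI Cor 2.3(i) p.47] -/
theorem hHstab_of_mem_decompSubgroups_of_edgeStable (P : PiData X d S T) {TpH : Subgroup S.chart.G}
    (hTpH : TpH ∈ S.chart.decompSubgroups P.H)
    (hHE : ∀ (g : X.PiTemp) (F₀ : Hom S.graph S.graph), F₀.IsIso →
      S.GraphCompatible S (S.autOfConj P.admissibleKer_normal_pi g) F₀ →
        ∀ e : S.graph.graph.Edge, e.1 ∈ P.H.edges ↔ (F₀.base.edgeMap e).1 ∈ P.H.edges) :
    ∀ g : X.PiTemp, ∃ t : S.chart.G,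
      TpH.map (S.autOfConj P.admissibleKer_normal_pi g).toMulEquiv.toMonoidHom = MulAut.conj t • TpH := by
  intro g
  have hD := hTpH
  rw [P.decompSubgroups_H_eq_graphOf] at hD
  exact P.exists_conj_map_autOfConj_of_mem_decompSubgroups g (H₀ := P.H.restrictTo S.Gc.graph.maximalSubgraph)
    (fun _ => Iff.rfl) (fun F₀ hF₀ hc e => hHE g F₀ hF₀ hc e) hD

/-- The F₀-form, one `g` at a time: given an isomorphism `F₀ : 𝒢 ⥲ 𝒢` compatible with `autOfConj g` (gen 11's A1 /
stage 1 supply one) stabilising the nodes of `ℍ`, `hHstab` holds at `g` for every decomposition group of `ℍ`.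
[cite: Mochizuki2012, IUTchI Cor 2.3(i) p.47] -/
theorem hHstab_at_of_graphCompatible (P : PiData X d S T) {TpH : Subgroup S.chart.G}
    (hTpH : TpH ∈ S.chart.decompSubgroups P.H) (g : X.PiTemp) {F₀ : Hom S.graph S.graph} (hF₀ : F₀.IsIso)
    (h : S.GraphCompatible S (S.autOfConj P.admissibleKer_normal_pi g) F₀)
    (hE : ∀ e : S.graph.graph.Edge, e.1 ∈ P.H.edges ↔ (F₀.base.edgeMap e).1 ∈ P.H.edges) :
    ∃ t : S.chart.G,
      TpH.map (S.autOfConj P.admissibleKer_normal_pi g).toMulEquiv.toMonoidHom = MulAut.conj t • TpH := by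
  have hD := hTpH
  rw [P.decompSubgroups_H_eq_graphOf] at hD
  exact P.exists_conj_map_autOfConj_of_graphCompatible g hF₀ h (H₀ := P.H.restrictTo S.Gc.graph.maximalSubgraph)
    (fun _ => Iff.rfl) hE hD

end PiData

end SpecialFibreTower

/-! ### §5. The edge hypothesis discharged for NODE-FULL `ℍ` -/

namespace SemiGraph.Subgraph

/-- **An automorphism of a semi-graph stabilising the vertices of a FULL sub-semi-graph stabilises its edges**: if
`e ∈ ℍ₀ ⟺ every vertex to which a branch of e abuts lies in ℍ₀` (fullness + vertex-closedness of `ℍ₀`), then for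
every automorphism `f` with `f⁻¹(ℍ₀.verts) = ℍ₀.verts`: `e ∈ ℍ₀ ⟺ f e ∈ ℍ₀` (§1 p. 12: sub-semi-graphs and the
incidence maps). [cite: MochizukiSemiAnbd2006, §1 p.12] -/
theorem mem_edges_iff_edgeMap_mem_of_full {G : SemiGraph.{u}} (H₀ : G.Subgraph)
    (hfull : ∀ e : G.Edge, e ∈ H₀.edges ↔
      ∀ (b : G.Branch) (v : G.Vertex), G.edgeOf b = e → G.abuts b = some v → v ∈ H₀.verts)
    (f : G ⟶ G) [IsIso f] (hV : ∀ v, v ∈ H₀.verts ↔ f.vertexMap v ∈ H₀.verts) (e : G.Edge) :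
    e ∈ H₀.edges ↔ f.edgeMap e ∈ H₀.edges := by
  rw [hfull e, hfull (f.edgeMap e)]
  constructor
  · intro he b' v' hb' hv'
    have hb : G.edgeOf ((inv f).branchMap b') = e := by
      rw [(inv f).edgeOf_branchMap, hb', SemiGraph.inv_edgeMap_edgeMap]
    have h := he _ _ hb ((inv f).abuts_branchMap b' v' hv')
    rwa [hV, SemiGraph.vertexMap_inv_vertexMap] at h
  · intro he b v hb hv
    have hb' : G.edgeOf (f.branchMap b) = f.edgeMap e := by rw [f.edgeOf_branchMap, hb]
    exact (hV v).mpr (he _ _ hb' (f.abuts_branchMap b v hv))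

end SemiGraph.Subgraph

namespace SpecialFibreData

variable {K : Type u} [Field K] {D : TemperedArithmeticGroup K} (S : SpecialFibreData D)

/-- At the cusp-omitted special fibre: an ISOMORPHISM `F₀ : 𝒢 ⥲ 𝒢` of semi-graphs of anabelioids stabilising the
vertices of a node-full `ℍ₀ ⊆ 𝒢` stabilises its edges. [cite: MochizukiSemiAnbd2006, §1 p.12] -/
theorem mem_edges_iff_of_full {H₀ : S.graph.graph.Subgraph}
    (hfull : ∀ e : S.graph.graph.Edge, e ∈ H₀.edges ↔
      ∀ (b : S.graph.graph.Branch) (v : S.graph.graph.Vertex),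
        S.graph.graph.edgeOf b = e → S.graph.graph.abuts b = some v → v ∈ H₀.verts)
    {F₀ : Hom S.graph S.graph} (hF₀ : F₀.IsIso) (hV : ∀ v, v ∈ H₀.verts ↔ F₀.base.vertexMap v ∈ H₀.verts)
    (e : S.graph.graph.Edge) : e ∈ H₀.edges ↔ F₀.base.edgeMap e ∈ H₀.edges := by
  haveI := hF₀.isIso_base
  exact H₀.mem_edges_iff_edgeMap_mem_of_full hfull (F₀.base : S.graph.graph ⟶ S.graph.graph) hV e

end SpecialFibreData

namespace SpecialFibreTower

namespace PiData

open SpecialFibreData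

variable {p : ℕ} [Fact p.Prime] {X : TemperedCurve p} {d : X.GroupLevelData}
  {S : SpecialFibreData (X.toTemperedArithmeticGroup d)} {T : SpecialFibreTower X.DeltaTemp}

/-- ★★★ **`hHstab` for NODE-FULL `ℍ`, hypothesis-free** beyond fullness: for `P : PiData` (finite base fibre) whose
`ℍ` contains a node of `𝔾^c` iff it contains both of its end-vertices, EVERY decomposition group
`Π^tp_ℍ := TpH ∈ decompSubgroups S.chart P.H` and every `g ∈ Π^tp_X` satisfy
`∃ t, TpH.map (autOfConj g) = MulAut.conj t • TpH` — abc-iut-L5's `hHstab` with NO origin datum, NO cusp matching and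
NO edge binder: Cor. 3.9 at the finite cusp-omitted fibre (stage 1), cusp-omission invariance of `Π^tp_ℍ` (§2–§4),
vertex-stability from `H_stable`, edge-stability from fullness (§5). [cite: Mochizuki2012, IUTchI Cor 2.3(i) p.47] -/
theorem hHstab_of_mem_decompSubgroups_of_full (P : PiData X d S T) {TpH : Subgroup S.chart.G}
    (hTpH : TpH ∈ S.chart.decompSubgroups P.H)
    (hfull : ∀ e : S.graph.graph.Edge, e.1 ∈ P.H.edges ↔
      ∀ (b : S.graph.graph.Branch) (v : S.graph.graph.Vertex),
        S.graph.graph.edgeOf b = e → S.graph.graph.abuts b = some v → v.1 ∈ P.H.verts) :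
    ∀ g : X.PiTemp, ∃ t : S.chart.G,
      TpH.map (S.autOfConj P.admissibleKer_normal_pi g).toMulEquiv.toMonoidHom = MulAut.conj t • TpH := by
  intro g
  haveI := P.finite_vertex; haveI := P.finite_edge
  obtain ⟨F₀, hF₀, hc, -, -⟩ := S.exists_isIso_inducesUpToTwist_autOfConj P.admissibleKer_normal_pi g
  have hV : ∀ v : S.graph.graph.Vertex, v ∈ (P.H.restrictTo S.Gc.graph.maximalSubgraph).verts ↔
      F₀.base.vertexMap v ∈ (P.H.restrictTo S.Gc.graph.maximalSubgraph).verts := fun v =>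
    calc v ∈ (P.H.restrictTo S.Gc.graph.maximalSubgraph).verts ↔ v.1 ∈ P.H.verts := Iff.rfl
      _ ↔ (P.actGraph₀ g).hom.vertexMap v.1 ∈ P.H.verts := P.mem_H_verts_iff_actGraph₀ g v.1
      _ ↔ (F₀.base.vertexMap v).1 ∈ P.H.verts := by
          rw [P.vertexMap_eq_actGraph₀_of_graphCompatible g hF₀.isLocallyTrivial.isLocallyOpen hc v]
      _ ↔ F₀.base.vertexMap v ∈ (P.H.restrictTo S.Gc.graph.maximalSubgraph).verts := Iff.rfl
  exact P.hHstab_at_of_graphCompatible hTpH g hF₀ hc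
    (S.mem_edges_iff_of_full (H₀ := P.H.restrictTo S.Gc.graph.maximalSubgraph) hfull hF₀ hV)

end PiData

end SpecialFibreTower

end Literature.AnabelianGeometry.SemiGraphs

end
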